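import Summits.AtomisticToContinuum.FouriersLaw.Theorems.LatticeLandauDampingAbelThermodynamicLimitOfSignLawsHalves
import Literature.MathematicalPhysics.KineticTheory.InfiniteChainTightRegular

/-!
# Crux `AbelThermodynamicLimit` from the two sign laws, and from its two halves (line SketchIdeator2, lead c2, cycle 3)

Support file for the crux `stmt-AtomisticToContinuum-14013` (`LatticeLandauDamping.AbelThermodynamicLimit`; `Iff.rfl`-twin
`stmt-12596`). Companion of `…OfSignLawsHalves.lean` (lead c1, p127001), which proves the two HALVES of the line's composition at
a REGULAR witness from one conjectural sign law each. This file makes the whole reduction importable and records, BY NAME, what the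
crux is now open at:

* `abelThermodynamicLimit_of_halves` — the strategist's item-level split D2 (STRATEGY-CENSUS.md §Decomposition), glue PROVED in
  binder form: `WitnessShiftInvariant → NoOvershoot → NoDeficit → AbelThermodynamicLimit`, where `WitnessShiftInvariant` is the
  registered seam stub `stub_witnessShiftInvariant` verbatim (the planner-level repair "the witness state may be taken
  shift-invariant") and `NoOvershoot` / `NoDeficit` are the two one-sided halves of the conclusion (`eventually Dn N ≤ κ + ε`,
  resp. `κ − ε ≤ Dn N`) at SHIFT-INVARIANT witnesses, with the crux's own binders. Pure logic (an `ε/2` squeeze). Ready for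
  `ledger route edit … --split AbelThermodynamicLimit --into children.json --glue-by <this decl>`.
* `abelThermodynamicLimitRepaired_of_halves` — the same two halves ALONE prove the planner-REPAIRED crux (shift-invariance added to
  the witness clause of the hypothesis; conclusion verbatim).
* `noOvershoot_of_quasiSuperadditivity_shiftInvariant` / `noDeficit_of_quasiSuperadditiveResistance_shiftInvariant` — the halves
  from QS resp. QSR (registered stubs `stub_quasiSuperadditivity` / `stub_quasiSuperadditiveResistance`, verbatim, as hypotheses) at
  every SHIFT-INVARIANT witness: shift-invariant ⇒ one-site tight ⇒ (transfer-operator state) shift-invariant + BM-superstable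
  (Literature `InfiniteChainTightRegular`), every `μT`-preserving dynamics is then carried by all-time `bmGood` orbits
  (`ae_forall_flow_mem_bmGood_pinnedChain`) and restricting it to those orbits (`exists_restrictOrbits`) keeps the flow, hence the
  correlations, the Abel limit AND `κ`; then the landed regular-witness halves apply.
* `stub_cruxOfSignLaws` — the registered composition stub of the line (lead c1, rev 8), PROVED: QS → QSR → SI → the crux BY NAME;
  it literally factors through the split. `abelThermodynamicLimitRepaired_of_signLaws`: QS → QSR → the repaired crux.

So after this file the crux as filed is open exactly at {QS, QSR, SI} and the repaired crux exactly at {QS, QSR} — equivalently at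
{NoOvershoot, NoDeficit}, of which QS/QSR are the rate-carrying (de Bruijn–Erdős, `O(N^θ)`) sufficient forms. Nothing here closes
the item.
-/

noncomputable section

namespace Summit.AtomisticToContinuum.FouriersLaw.Theorems.AbelThermodynamicLimit.SeriesLawAtEveryLaplaceFrequency

open MeasureTheory Filter Set Topology
open Literature.MathematicalPhysics.KineticTheory.HeatConduction

/-- **Same-`κ` regularisation of the dynamics at a regular state.** If the witness state `μT` of the pinned chain
(`ω₂ > 0`, `lam, β > 0`) is shift-invariant and BM-superstable, then for ANY `μT`-preserving dynamics `D'` with absolutely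
convergent correlations and Abel limit `κ`, the restriction of `D'` to the orbits staying in `bmGood` (a `μT`-full set, sup-in-time
BM estimate) is a dynamics with carrier `⊆ bmGood`, the SAME flow, hence the same measure preservation, correlations and Abel
limit `κ` (sharpening of `regularWitness_of_regularState_of_aeOrbits`, which hides `κ` behind an `∃`). [folklore] -/
theorem exists_regularDynamics_sameKappa {ω₂ lam β γ T κ : ℝ} (hω : 0 < ω₂) (hl : 0 < lam) (hβ : 0 < β)
    {μT : Measure ChainConfig} (D' : InfiniteChainDynamics (pinnedChain ω₂ lam β γ))
    (hss : (pinnedChain ω₂ lam β γ).HasSuperstabilityEstimate μT) (hP : D'.PreservesMeasure μT)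
    (hAC : ∀ t : ℝ, D'.HasAbsConvergentCorrelation μT t)
    (hlim : Tendsto (fun ν : ℝ => (T ^ 2)⁻¹ *
        ∫ t in Ioi (0:ℝ), Real.exp (-(ν * t)) * D'.currentCorrelation μT t) (𝓝[>] 0) (𝓝 κ)) :
    ∃ D : InfiniteChainDynamics (pinnedChain ω₂ lam β γ),
      D.carrier ⊆ (pinnedChain ω₂ lam β γ).bmGood ∧ D.PreservesMeasure μT ∧
      (∀ t : ℝ, D.HasAbsConvergentCorrelation μT t) ∧
      Tendsto (fun ν : ℝ => (T ^ 2)⁻¹ *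
        ∫ t in Ioi (0:ℝ), Real.exp (-(ν * t)) * D.currentCorrelation μT t) (𝓝[>] 0) (𝓝 κ) := by
  have horb : ∀ᵐ σ ∂μT, ∀ t : ℝ, D'.flow t σ ∈ (pinnedChain ω₂ lam β γ).bmGood :=
    OscillatorChain.ae_forall_flow_mem_bmGood_pinnedChain γ hω.le hl hβ hss D' hP
  obtain ⟨D, hcar, hflow⟩ :=
    GreenKuboContinuation.TemperatureBlindVitaliHurwitz.exists_restrictOrbits D' (pinnedChain ω₂ lam β γ).bmGood
  refine ⟨D, ?_, ?_, ?_, ?_⟩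
  · intro σ hσ
    rw [hcar] at hσ
    have h0 := hσ.2 0
    rwa [D'.flow_zero σ hσ.1] at h0
  · refine GreenKuboContinuation.TemperatureBlindVitaliHurwitz.preservesMeasure_of_flow_eq hflow ?_ hP
    rw [hcar]
    filter_upwards [hP.1, horb] with σ h1 h2 using ⟨h1, h2⟩
  · intro t
    rw [GreenKuboContinuation.TemperatureBlindVitaliHurwitz.hasAbsConvergentCorrelation_iff_of_flow_eq hflow]
    exact hAC t
  · rw [GreenKuboContinuation.TemperatureBlindVitaliHurwitz.currentCorrelation_eq_of_flow_eq hflow]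
    exact hlim

/-- **UPPER HALF at every SHIFT-INVARIANT witness from QS** (`NoOvershoot` child of the split): for `P` (all `> 0`), `Uniq`,
`T > 0`, every witness `(μT, D, κ)` whose DLR state is shift-invariant, every steady family and response sequence `Dn`:
`∀ ε > 0`, eventually `Dn N ≤ κ + ε` — IF the conductance-side sign law QS (`stub_quasiSuperadditivity`, verbatim, hypothesis
`hQS`) holds. Proof: shift-invariant ⇒ tight ⇒ regular state; `exists_regularDynamics_sameKappa`; landed
`noOvershoot_of_quasiSuperadditivity`. [folklore] -/
theorem noOvershoot_of_quasiSuperadditivity_shiftInvariant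
    (hQS :
      ∀ ω₂ lam β γ : ℝ, 0 < ω₂ → 0 < lam → 0 < β → 0 < γ → ∀ T : ℝ, 0 < T →
      let F : ℕ → ℝ → ℝ := fun N ν =>
      MeasureTheory.integral (MeasureTheory.volume.restrict (Set.Ioi (0:ℝ))) (fun t : ℝ =>
      Real.exp (-(ν * t)) *
      ∫ z, (∑ i : Fin N, (Literature.MathematicalPhysics.KineticTheory.HeatConduction.pinnedChain ω₂ lam β γ).bondCurrent N i z) *
      (∫ y, (∑ i : Fin N, (Literature.MathematicalPhysics.KineticTheory.HeatConduction.pinnedChain ω₂ lam β γ).bondCurrent N i y) ∂((Literature.MathematicalPhysics.KineticTheory.HeatConduction.pinnedChain ω₂ lam β γ).transitionKernel N T T t.toNNReal z))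
      ∂((Literature.MathematicalPhysics.KineticTheory.HeatConduction.pinnedChain ω₂ lam β γ).gibbsMeasure N T));
      ∃ C θ ν₀ : ℝ, ∃ N₀ : ℕ, 0 ≤ C ∧ θ < 1 ∧ 0 < ν₀ ∧ ∀ ν : ℝ, 0 < ν → ν ≤ ν₀ → ∀ N : ℕ, N₀ ≤ N →
      2 * F N ν - C * ((2 * N : ℕ) : ℝ) ^ θ ≤ F (2 * N) ν) :
    ∀ ω₂ lam β γ : ℝ, 0 < ω₂ → 0 < lam → 0 < β → 0 < γ →
    (∀ (N : ℕ) (T_L T_R : ℝ), 0 < T_L → 0 < T_R → ∀ μ ν : MeasureTheory.Measure (Literature.MathematicalPhysics.KineticTheory.HeatConduction.PhaseSpace N),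
    (Literature.MathematicalPhysics.KineticTheory.HeatConduction.pinnedChain ω₂ lam β γ).IsSteadyState N T_L T_R μ → (Literature.MathematicalPhysics.KineticTheory.HeatConduction.pinnedChain ω₂ lam β γ).IsSteadyState N T_L T_R ν → μ = ν) →
    ∀ T : ℝ, 0 < T →
    ∀ (μT : MeasureTheory.Measure Literature.MathematicalPhysics.KineticTheory.HeatConduction.ChainConfig) (D : Literature.MathematicalPhysics.KineticTheory.HeatConduction.InfiniteChainDynamics (Literature.MathematicalPhysics.KineticTheory.HeatConduction.pinnedChain ω₂ lam β γ)) (κ : ℝ),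
    (Literature.MathematicalPhysics.KineticTheory.HeatConduction.pinnedChain ω₂ lam β γ).IsChainGibbsMeasure T μT → Literature.MathematicalPhysics.KineticTheory.HeatConduction.IsShiftInvariant μT → D.PreservesMeasure μT →
    (∀ t : ℝ, D.HasAbsConvergentCorrelation μT t) → 0 < κ →
    Filter.Tendsto (fun ν : ℝ => (T ^ 2)⁻¹ * MeasureTheory.integral (MeasureTheory.volume.restrict (Set.Ioi (0:ℝ)))
    (fun t : ℝ => Real.exp (-(ν * t)) * (D.currentCorrelation μT) t)) (nhdsWithin (0:ℝ) (Set.Ioi 0)) (nhds κ) →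
    ∀ μ : (N : ℕ) → ℝ → ℝ → MeasureTheory.Measure (Literature.MathematicalPhysics.KineticTheory.HeatConduction.PhaseSpace N),
    (∀ (N : ℕ) (T_L T_R : ℝ), 0 < T_L → 0 < T_R → (Literature.MathematicalPhysics.KineticTheory.HeatConduction.pinnedChain ω₂ lam β γ).IsSteadyState N T_L T_R (μ N T_L T_R)) →
    ∀ Dn : ℕ → ℝ,
    (∀ N : ℕ, Filter.Tendsto (fun δ : ℝ => (Literature.MathematicalPhysics.KineticTheory.HeatConduction.pinnedChain ω₂ lam β γ).totalCurrent (μ N (T + δ / 2) (T - δ / 2)) / δ)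
    (nhdsWithin 0 {(0 : ℝ)}ᶜ) (nhds (Dn N))) →
    ∀ ε : ℝ, 0 < ε → ∃ N₀ : ℕ, ∀ N : ℕ, N₀ ≤ N → Dn N ≤ κ + ε := by
  intro ω₂ lam β γ hω hl hβ hγ hU T hT μ₁ D₁ κ hG₁ hS₁ hP₁ hAC₁ hκ hlim₁ μ hμ Dn hD
  haveI : IsProbabilityMeasure μ₁ := hG₁.1
  have htight := Literature.MathematicalPhysics.KineticTheory.HeatConduction.oneSiteTight_of_isShiftInvariant
    (μ := μ₁) hS₁
  obtain ⟨hS, hss⟩ :=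
    OscillatorChain.isShiftInvariant_and_hasSuperstabilityEstimate_of_tight_pinnedChain γ hω hl.le hβ.le hT hG₁ htight
  obtain ⟨D, hcar, hP, hAC, hAbel⟩ := exists_regularDynamics_sameKappa hω hl hβ D₁ hss hP₁ hAC₁ hlim₁
  exact noOvershoot_of_quasiSuperadditivity hω hl hβ hγ hU hT hG₁ hS hss hcar hP hAC hAbel
    (hQS ω₂ lam β γ hω hl hβ hγ T hT) μ hμ Dn hD

/-- **LOWER HALF at every SHIFT-INVARIANT witness from QSR** (`NoDeficit` child of the split): same setting, `∀ ε > 0`,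
eventually `κ − ε ≤ Dn N` — IF the resistance-side sign law QSR (`stub_quasiSuperadditiveResistance`, verbatim, hypothesis
`hQSR`) holds. Proof: as above with the landed `noDeficit_of_quasiSuperadditiveResistance` (which also yields `0 < Dn N`). [folklore] -/
theorem noDeficit_of_quasiSuperadditiveResistance_shiftInvariant
    (hQSR :
      ∀ ω₂ lam β γ : ℝ, 0 < ω₂ → 0 < lam → 0 < β → 0 < γ → ∀ T : ℝ, 0 < T →
      let F : ℕ → ℝ → ℝ := fun N ν =>
      MeasureTheory.integral (MeasureTheory.volume.restrict (Set.Ioi (0:ℝ))) (fun t : ℝ =>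
      Real.exp (-(ν * t)) *
      ∫ z, (∑ i : Fin N, (Literature.MathematicalPhysics.KineticTheory.HeatConduction.pinnedChain ω₂ lam β γ).bondCurrent N i z) *
      (∫ y, (∑ i : Fin N, (Literature.MathematicalPhysics.KineticTheory.HeatConduction.pinnedChain ω₂ lam β γ).bondCurrent N i y) ∂((Literature.MathematicalPhysics.KineticTheory.HeatConduction.pinnedChain ω₂ lam β γ).transitionKernel N T T t.toNNReal z))
      ∂((Literature.MathematicalPhysics.KineticTheory.HeatConduction.pinnedChain ω₂ lam β γ).gibbsMeasure N T));
      let R : ℕ → ℝ → ℝ := fun N ν => ((N : ℝ) - 1) ^ 2 * T ^ 2 / F N ν;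
      ∃ C θ ν₀ : ℝ, ∃ N₀ : ℕ, 0 ≤ C ∧ θ < 1 ∧ 0 < ν₀ ∧ ∀ ν : ℝ, 0 < ν → ν ≤ ν₀ → ∀ N : ℕ, N₀ ≤ N →
      2 * R N ν - C * ((2 * N : ℕ) : ℝ) ^ θ ≤ R (2 * N) ν) :
    ∀ ω₂ lam β γ : ℝ, 0 < ω₂ → 0 < lam → 0 < β → 0 < γ →
    (∀ (N : ℕ) (T_L T_R : ℝ), 0 < T_L → 0 < T_R → ∀ μ ν : MeasureTheory.Measure (Literature.MathematicalPhysics.KineticTheory.HeatConduction.PhaseSpace N),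
    (Literature.MathematicalPhysics.KineticTheory.HeatConduction.pinnedChain ω₂ lam β γ).IsSteadyState N T_L T_R μ → (Literature.MathematicalPhysics.KineticTheory.HeatConduction.pinnedChain ω₂ lam β γ).IsSteadyState N T_L T_R ν → μ = ν) →
    ∀ T : ℝ, 0 < T →
    ∀ (μT : MeasureTheory.Measure Literature.MathematicalPhysics.KineticTheory.HeatConduction.ChainConfig) (D : Literature.MathematicalPhysics.KineticTheory.HeatConduction.InfiniteChainDynamics (Literature.MathematicalPhysics.KineticTheory.HeatConduction.pinnedChain ω₂ lam β γ)) (κ : ℝ),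
    (Literature.MathematicalPhysics.KineticTheory.HeatConduction.pinnedChain ω₂ lam β γ).IsChainGibbsMeasure T μT → Literature.MathematicalPhysics.KineticTheory.HeatConduction.IsShiftInvariant μT → D.PreservesMeasure μT →
    (∀ t : ℝ, D.HasAbsConvergentCorrelation μT t) → 0 < κ →
    Filter.Tendsto (fun ν : ℝ => (T ^ 2)⁻¹ * MeasureTheory.integral (MeasureTheory.volume.restrict (Set.Ioi (0:ℝ)))
    (fun t : ℝ => Real.exp (-(ν * t)) * (D.currentCorrelation μT) t)) (nhdsWithin (0:ℝ) (Set.Ioi 0)) (nhds κ) →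
    ∀ μ : (N : ℕ) → ℝ → ℝ → MeasureTheory.Measure (Literature.MathematicalPhysics.KineticTheory.HeatConduction.PhaseSpace N),
    (∀ (N : ℕ) (T_L T_R : ℝ), 0 < T_L → 0 < T_R → (Literature.MathematicalPhysics.KineticTheory.HeatConduction.pinnedChain ω₂ lam β γ).IsSteadyState N T_L T_R (μ N T_L T_R)) →
    ∀ Dn : ℕ → ℝ,
    (∀ N : ℕ, Filter.Tendsto (fun δ : ℝ => (Literature.MathematicalPhysics.KineticTheory.HeatConduction.pinnedChain ω₂ lam β γ).totalCurrent (μ N (T + δ / 2) (T - δ / 2)) / δ)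
    (nhdsWithin 0 {(0 : ℝ)}ᶜ) (nhds (Dn N))) →
    ∀ ε : ℝ, 0 < ε → ∃ N₀ : ℕ, ∀ N : ℕ, N₀ ≤ N → κ - ε ≤ Dn N := by
  intro ω₂ lam β γ hω hl hβ hγ hU T hT μ₁ D₁ κ hG₁ hS₁ hP₁ hAC₁ hκ hlim₁ μ hμ Dn hD ε hε
  haveI : IsProbabilityMeasure μ₁ := hG₁.1
  have htight := Literature.MathematicalPhysics.KineticTheory.HeatConduction.oneSiteTight_of_isShiftInvariant
    (μ := μ₁) hS₁
  obtain ⟨hS, hss⟩ :=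
    OscillatorChain.isShiftInvariant_and_hasSuperstabilityEstimate_of_tight_pinnedChain γ hω hl.le hβ.le hT hG₁ htight
  obtain ⟨D, hcar, hP, hAC, hAbel⟩ := exists_regularDynamics_sameKappa hω hl hβ D₁ hss hP₁ hAC₁ hlim₁
  obtain ⟨N₃, h3⟩ := noDeficit_of_quasiSuperadditiveResistance hω hl hβ hγ hU hT hG₁ hS hss hcar hP hAC hκ hAbel
    (hQSR ω₂ lam β γ hω hl hβ hγ T hT) μ hμ Dn hD ε hε
  exact ⟨N₃, fun N hN => (h3 N hN).2⟩

/-- **The REPAIRED crux from its two halves** (pure logic): if at every shift-invariant witness every response sequence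
eventually stays below `κ + ε` (`NoOvershoot`) and above `κ − ε` (`NoDeficit`), then the crux with the witness clause of its
HYPOTHESIS strengthened by `IsShiftInvariant μT` — the planner-level repair recommended by every seat of this crux — holds:
output the given witness and squeeze. [folklore] -/
theorem abelThermodynamicLimitRepaired_of_halves
    (hNO :
      ∀ ω₂ lam β γ : ℝ, 0 < ω₂ → 0 < lam → 0 < β → 0 < γ →
      (∀ (N : ℕ) (T_L T_R : ℝ), 0 < T_L → 0 < T_R → ∀ μ ν : MeasureTheory.Measure (Literature.MathematicalPhysics.KineticTheory.HeatConduction.PhaseSpace N),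
      (Literature.MathematicalPhysics.KineticTheory.HeatConduction.pinnedChain ω₂ lam β γ).IsSteadyState N T_L T_R μ → (Literature.MathematicalPhysics.KineticTheory.HeatConduction.pinnedChain ω₂ lam β γ).IsSteadyState N T_L T_R ν → μ = ν) →
      ∀ T : ℝ, 0 < T →
      ∀ (μT : MeasureTheory.Measure Literature.MathematicalPhysics.KineticTheory.HeatConduction.ChainConfig) (D : Literature.MathematicalPhysics.KineticTheory.HeatConduction.InfiniteChainDynamics (Literature.MathematicalPhysics.KineticTheory.HeatConduction.pinnedChain ω₂ lam β γ)) (κ : ℝ),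
      (Literature.MathematicalPhysics.KineticTheory.HeatConduction.pinnedChain ω₂ lam β γ).IsChainGibbsMeasure T μT → Literature.MathematicalPhysics.KineticTheory.HeatConduction.IsShiftInvariant μT → D.PreservesMeasure μT →
      (∀ t : ℝ, D.HasAbsConvergentCorrelation μT t) → 0 < κ →
      Filter.Tendsto (fun ν : ℝ => (T ^ 2)⁻¹ * MeasureTheory.integral (MeasureTheory.volume.restrict (Set.Ioi (0:ℝ)))
      (fun t : ℝ => Real.exp (-(ν * t)) * (D.currentCorrelation μT) t)) (nhdsWithin (0:ℝ) (Set.Ioi 0)) (nhds κ) →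
      ∀ μ : (N : ℕ) → ℝ → ℝ → MeasureTheory.Measure (Literature.MathematicalPhysics.KineticTheory.HeatConduction.PhaseSpace N),
      (∀ (N : ℕ) (T_L T_R : ℝ), 0 < T_L → 0 < T_R → (Literature.MathematicalPhysics.KineticTheory.HeatConduction.pinnedChain ω₂ lam β γ).IsSteadyState N T_L T_R (μ N T_L T_R)) →
      ∀ Dn : ℕ → ℝ,
      (∀ N : ℕ, Filter.Tendsto (fun δ : ℝ => (Literature.MathematicalPhysics.KineticTheory.HeatConduction.pinnedChain ω₂ lam β γ).totalCurrent (μ N (T + δ / 2) (T - δ / 2)) / δ)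
      (nhdsWithin 0 {(0 : ℝ)}ᶜ) (nhds (Dn N))) →
      ∀ ε : ℝ, 0 < ε → ∃ N₀ : ℕ, ∀ N : ℕ, N₀ ≤ N → Dn N ≤ κ + ε)
    (hND :
      ∀ ω₂ lam β γ : ℝ, 0 < ω₂ → 0 < lam → 0 < β → 0 < γ →
      (∀ (N : ℕ) (T_L T_R : ℝ), 0 < T_L → 0 < T_R → ∀ μ ν : MeasureTheory.Measure (Literature.MathematicalPhysics.KineticTheory.HeatConduction.PhaseSpace N),
      (Literature.MathematicalPhysics.KineticTheory.HeatConduction.pinnedChain ω₂ lam β γ).IsSteadyState N T_L T_R μ → (Literature.MathematicalPhysics.KineticTheory.HeatConduction.pinnedChain ω₂ lam β γ).IsSteadyState N T_L T_R ν → μ = ν) →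
      ∀ T : ℝ, 0 < T →
      ∀ (μT : MeasureTheory.Measure Literature.MathematicalPhysics.KineticTheory.HeatConduction.ChainConfig) (D : Literature.MathematicalPhysics.KineticTheory.HeatConduction.InfiniteChainDynamics (Literature.MathematicalPhysics.KineticTheory.HeatConduction.pinnedChain ω₂ lam β γ)) (κ : ℝ),
      (Literature.MathematicalPhysics.KineticTheory.HeatConduction.pinnedChain ω₂ lam β γ).IsChainGibbsMeasure T μT → Literature.MathematicalPhysics.KineticTheory.HeatConduction.IsShiftInvariant μT → D.PreservesMeasure μT →
      (∀ t : ℝ, D.HasAbsConvergentCorrelation μT t) → 0 < κ →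
      Filter.Tendsto (fun ν : ℝ => (T ^ 2)⁻¹ * MeasureTheory.integral (MeasureTheory.volume.restrict (Set.Ioi (0:ℝ)))
      (fun t : ℝ => Real.exp (-(ν * t)) * (D.currentCorrelation μT) t)) (nhdsWithin (0:ℝ) (Set.Ioi 0)) (nhds κ) →
      ∀ μ : (N : ℕ) → ℝ → ℝ → MeasureTheory.Measure (Literature.MathematicalPhysics.KineticTheory.HeatConduction.PhaseSpace N),
      (∀ (N : ℕ) (T_L T_R : ℝ), 0 < T_L → 0 < T_R → (Literature.MathematicalPhysics.KineticTheory.HeatConduction.pinnedChain ω₂ lam β γ).IsSteadyState N T_L T_R (μ N T_L T_R)) →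
      ∀ Dn : ℕ → ℝ,
      (∀ N : ℕ, Filter.Tendsto (fun δ : ℝ => (Literature.MathematicalPhysics.KineticTheory.HeatConduction.pinnedChain ω₂ lam β γ).totalCurrent (μ N (T + δ / 2) (T - δ / 2)) / δ)
      (nhdsWithin 0 {(0 : ℝ)}ᶜ) (nhds (Dn N))) →
      ∀ ε : ℝ, 0 < ε → ∃ N₀ : ℕ, ∀ N : ℕ, N₀ ≤ N → κ - ε ≤ Dn N) :
    ∀ ω₂ lam β γ : ℝ, 0 < ω₂ → 0 < lam → 0 < β → 0 < γ →
    (∀ (N : ℕ) (T_L T_R : ℝ), 0 < T_L → 0 < T_R → ∀ μ ν : MeasureTheory.Measure (Literature.MathematicalPhysics.KineticTheory.HeatConduction.PhaseSpace N),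
    (Literature.MathematicalPhysics.KineticTheory.HeatConduction.pinnedChain ω₂ lam β γ).IsSteadyState N T_L T_R μ → (Literature.MathematicalPhysics.KineticTheory.HeatConduction.pinnedChain ω₂ lam β γ).IsSteadyState N T_L T_R ν → μ = ν) →
    ∀ T : ℝ, 0 < T →
    (∃ (μT : MeasureTheory.Measure Literature.MathematicalPhysics.KineticTheory.HeatConduction.ChainConfig) (D : Literature.MathematicalPhysics.KineticTheory.HeatConduction.InfiniteChainDynamics (Literature.MathematicalPhysics.KineticTheory.HeatConduction.pinnedChain ω₂ lam β γ)) (κ : ℝ),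
    (Literature.MathematicalPhysics.KineticTheory.HeatConduction.pinnedChain ω₂ lam β γ).IsChainGibbsMeasure T μT ∧ Literature.MathematicalPhysics.KineticTheory.HeatConduction.IsShiftInvariant μT ∧ D.PreservesMeasure μT ∧
    (∀ t : ℝ, D.HasAbsConvergentCorrelation μT t) ∧ 0 < κ ∧
    Filter.Tendsto (fun ν : ℝ => (T ^ 2)⁻¹ * MeasureTheory.integral (MeasureTheory.volume.restrict (Set.Ioi (0:ℝ)))
    (fun t : ℝ => Real.exp (-(ν * t)) * (D.currentCorrelation μT) t)) (nhdsWithin (0:ℝ) (Set.Ioi 0)) (nhds κ)) →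
    ∃ (μT : MeasureTheory.Measure Literature.MathematicalPhysics.KineticTheory.HeatConduction.ChainConfig) (D : Literature.MathematicalPhysics.KineticTheory.HeatConduction.InfiniteChainDynamics (Literature.MathematicalPhysics.KineticTheory.HeatConduction.pinnedChain ω₂ lam β γ)) (κ : ℝ),
    ((Literature.MathematicalPhysics.KineticTheory.HeatConduction.pinnedChain ω₂ lam β γ).IsChainGibbsMeasure T μT ∧ D.PreservesMeasure μT ∧
    (∀ t : ℝ, D.HasAbsConvergentCorrelation μT t) ∧ 0 < κ ∧
    Filter.Tendsto (fun ν : ℝ => (T ^ 2)⁻¹ * MeasureTheory.integral (MeasureTheory.volume.restrict (Set.Ioi (0:ℝ)))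
    (fun t : ℝ => Real.exp (-(ν * t)) * (D.currentCorrelation μT) t)) (nhdsWithin (0:ℝ) (Set.Ioi 0)) (nhds κ)) ∧
    ∀ μ : (N : ℕ) → ℝ → ℝ → MeasureTheory.Measure (Literature.MathematicalPhysics.KineticTheory.HeatConduction.PhaseSpace N),
    (∀ (N : ℕ) (T_L T_R : ℝ), 0 < T_L → 0 < T_R → (Literature.MathematicalPhysics.KineticTheory.HeatConduction.pinnedChain ω₂ lam β γ).IsSteadyState N T_L T_R (μ N T_L T_R)) →
    ∀ Dn : ℕ → ℝ,
    (∀ N : ℕ, Filter.Tendsto (fun δ : ℝ => (Literature.MathematicalPhysics.KineticTheory.HeatConduction.pinnedChain ω₂ lam β γ).totalCurrent (μ N (T + δ / 2) (T - δ / 2)) / δ)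
    (nhdsWithin 0 {(0 : ℝ)}ᶜ) (nhds (Dn N))) →
    Filter.Tendsto Dn Filter.atTop (nhds κ) := by
  intro ω₂ lam β γ hω hl hβ hγ hU T hT hex
  obtain ⟨μT, D, κ, hG, hS, hP, hAC, hκ, hlim⟩ := hex
  refine ⟨μT, D, κ, ⟨hG, hP, hAC, hκ, hlim⟩, ?_⟩
  intro μ hμ Dn hD
  rw [Metric.tendsto_atTop]
  intro ε hε
  obtain ⟨N₅, h5⟩ := hNO ω₂ lam β γ hω hl hβ hγ hU T hT μT D κ hG hS hP hAC hκ hlim μ hμ Dn hD (ε / 2) (by positivity)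
  obtain ⟨N₆, h6⟩ := hND ω₂ lam β γ hω hl hβ hγ hU T hT μT D κ hG hS hP hAC hκ hlim μ hμ Dn hD (ε / 2) (by positivity)
  refine ⟨max N₅ N₆, fun N hN => ?_⟩
  have a := h5 N (le_trans (le_max_left _ _) hN)
  have b := h6 N (le_trans (le_max_right _ _) hN)
  rw [Real.dist_eq, abs_lt]
  constructor <;> linarith

/-- **THE SPLIT GLUE (strategist D2), PROVED: `WitnessShiftInvariant → NoOvershoot → NoDeficit → AbelThermodynamicLimit`.**
`WitnessShiftInvariant` is the registered seam stub `stub_witnessShiftInvariant` verbatim ("IF a witness exists THEN one with a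
shift-invariant DLR state exists"); the two halves are as in `abelThermodynamicLimitRepaired_of_halves`. Proof: regularise the
given witness through the seam, output it, squeeze. Use: `ledger route edit route-AtomisticToContinuum-LatticeLandauDamping
--split AbelThermodynamicLimit --into children.json --glue-by <this decl>` (children = the three hypotheses, verbatim). [folklore] -/
theorem abelThermodynamicLimit_of_halves
    (hSI :
      ∀ ω₂ lam β γ : ℝ, 0 < ω₂ → 0 < lam → 0 < β → 0 < γ → ∀ T : ℝ, 0 < T →
      (∃ (μT : MeasureTheory.Measure Literature.MathematicalPhysics.KineticTheory.HeatConduction.ChainConfig)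
      (D' : Literature.MathematicalPhysics.KineticTheory.HeatConduction.InfiniteChainDynamics (Literature.MathematicalPhysics.KineticTheory.HeatConduction.pinnedChain ω₂ lam β γ)) (κ : ℝ),
      (Literature.MathematicalPhysics.KineticTheory.HeatConduction.pinnedChain ω₂ lam β γ).IsChainGibbsMeasure T μT ∧ D'.PreservesMeasure μT ∧
      (∀ t : ℝ, D'.HasAbsConvergentCorrelation μT t) ∧ 0 < κ ∧
      Filter.Tendsto (fun ν : ℝ => (T ^ 2)⁻¹ * MeasureTheory.integral (MeasureTheory.volume.restrict (Set.Ioi (0:ℝ)))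
      (fun t : ℝ => Real.exp (-(ν * t)) * D'.currentCorrelation μT t)) (nhdsWithin (0:ℝ) (Set.Ioi 0)) (nhds κ)) →
      ∃ (μT : MeasureTheory.Measure Literature.MathematicalPhysics.KineticTheory.HeatConduction.ChainConfig)
      (D' : Literature.MathematicalPhysics.KineticTheory.HeatConduction.InfiniteChainDynamics (Literature.MathematicalPhysics.KineticTheory.HeatConduction.pinnedChain ω₂ lam β γ)) (κ : ℝ),
      (Literature.MathematicalPhysics.KineticTheory.HeatConduction.pinnedChain ω₂ lam β γ).IsChainGibbsMeasure T μT ∧ Literature.MathematicalPhysics.KineticTheory.HeatConduction.IsShiftInvariant μT ∧ D'.PreservesMeasure μT ∧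
      (∀ t : ℝ, D'.HasAbsConvergentCorrelation μT t) ∧ 0 < κ ∧
      Filter.Tendsto (fun ν : ℝ => (T ^ 2)⁻¹ * MeasureTheory.integral (MeasureTheory.volume.restrict (Set.Ioi (0:ℝ)))
      (fun t : ℝ => Real.exp (-(ν * t)) * D'.currentCorrelation μT t)) (nhdsWithin (0:ℝ) (Set.Ioi 0)) (nhds κ))
    (hNO :
      ∀ ω₂ lam β γ : ℝ, 0 < ω₂ → 0 < lam → 0 < β → 0 < γ →
      (∀ (N : ℕ) (T_L T_R : ℝ), 0 < T_L → 0 < T_R → ∀ μ ν : MeasureTheory.Measure (Literature.MathematicalPhysics.KineticTheory.HeatConduction.PhaseSpace N),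
      (Literature.MathematicalPhysics.KineticTheory.HeatConduction.pinnedChain ω₂ lam β γ).IsSteadyState N T_L T_R μ → (Literature.MathematicalPhysics.KineticTheory.HeatConduction.pinnedChain ω₂ lam β γ).IsSteadyState N T_L T_R ν → μ = ν) →
      ∀ T : ℝ, 0 < T →
      ∀ (μT : MeasureTheory.Measure Literature.MathematicalPhysics.KineticTheory.HeatConduction.ChainConfig) (D : Literature.MathematicalPhysics.KineticTheory.HeatConduction.InfiniteChainDynamics (Literature.MathematicalPhysics.KineticTheory.HeatConduction.pinnedChain ω₂ lam β γ)) (κ : ℝ),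
      (Literature.MathematicalPhysics.KineticTheory.HeatConduction.pinnedChain ω₂ lam β γ).IsChainGibbsMeasure T μT → Literature.MathematicalPhysics.KineticTheory.HeatConduction.IsShiftInvariant μT → D.PreservesMeasure μT →
      (∀ t : ℝ, D.HasAbsConvergentCorrelation μT t) → 0 < κ →
      Filter.Tendsto (fun ν : ℝ => (T ^ 2)⁻¹ * MeasureTheory.integral (MeasureTheory.volume.restrict (Set.Ioi (0:ℝ)))
      (fun t : ℝ => Real.exp (-(ν * t)) * (D.currentCorrelation μT) t)) (nhdsWithin (0:ℝ) (Set.Ioi 0)) (nhds κ) →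
      ∀ μ : (N : ℕ) → ℝ → ℝ → MeasureTheory.Measure (Literature.MathematicalPhysics.KineticTheory.HeatConduction.PhaseSpace N),
      (∀ (N : ℕ) (T_L T_R : ℝ), 0 < T_L → 0 < T_R → (Literature.MathematicalPhysics.KineticTheory.HeatConduction.pinnedChain ω₂ lam β γ).IsSteadyState N T_L T_R (μ N T_L T_R)) →
      ∀ Dn : ℕ → ℝ,
      (∀ N : ℕ, Filter.Tendsto (fun δ : ℝ => (Literature.MathematicalPhysics.KineticTheory.HeatConduction.pinnedChain ω₂ lam β γ).totalCurrent (μ N (T + δ / 2) (T - δ / 2)) / δ)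
      (nhdsWithin 0 {(0 : ℝ)}ᶜ) (nhds (Dn N))) →
      ∀ ε : ℝ, 0 < ε → ∃ N₀ : ℕ, ∀ N : ℕ, N₀ ≤ N → Dn N ≤ κ + ε)
    (hND :
      ∀ ω₂ lam β γ : ℝ, 0 < ω₂ → 0 < lam → 0 < β → 0 < γ →
      (∀ (N : ℕ) (T_L T_R : ℝ), 0 < T_L → 0 < T_R → ∀ μ ν : MeasureTheory.Measure (Literature.MathematicalPhysics.KineticTheory.HeatConduction.PhaseSpace N),
      (Literature.MathematicalPhysics.KineticTheory.HeatConduction.pinnedChain ω₂ lam β γ).IsSteadyState N T_L T_R μ → (Literature.MathematicalPhysics.KineticTheory.HeatConduction.pinnedChain ω₂ lam β γ).IsSteadyState N T_L T_R ν → μ = ν) →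
      ∀ T : ℝ, 0 < T →
      ∀ (μT : MeasureTheory.Measure Literature.MathematicalPhysics.KineticTheory.HeatConduction.ChainConfig) (D : Literature.MathematicalPhysics.KineticTheory.HeatConduction.InfiniteChainDynamics (Literature.MathematicalPhysics.KineticTheory.HeatConduction.pinnedChain ω₂ lam β γ)) (κ : ℝ),
      (Literature.MathematicalPhysics.KineticTheory.HeatConduction.pinnedChain ω₂ lam β γ).IsChainGibbsMeasure T μT → Literature.MathematicalPhysics.KineticTheory.HeatConduction.IsShiftInvariant μT → D.PreservesMeasure μT →
      (∀ t : ℝ, D.HasAbsConvergentCorrelation μT t) → 0 < κ →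
      Filter.Tendsto (fun ν : ℝ => (T ^ 2)⁻¹ * MeasureTheory.integral (MeasureTheory.volume.restrict (Set.Ioi (0:ℝ)))
      (fun t : ℝ => Real.exp (-(ν * t)) * (D.currentCorrelation μT) t)) (nhdsWithin (0:ℝ) (Set.Ioi 0)) (nhds κ) →
      ∀ μ : (N : ℕ) → ℝ → ℝ → MeasureTheory.Measure (Literature.MathematicalPhysics.KineticTheory.HeatConduction.PhaseSpace N),
      (∀ (N : ℕ) (T_L T_R : ℝ), 0 < T_L → 0 < T_R → (Literature.MathematicalPhysics.KineticTheory.HeatConduction.pinnedChain ω₂ lam β γ).IsSteadyState N T_L T_R (μ N T_L T_R)) →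
      ∀ Dn : ℕ → ℝ,
      (∀ N : ℕ, Filter.Tendsto (fun δ : ℝ => (Literature.MathematicalPhysics.KineticTheory.HeatConduction.pinnedChain ω₂ lam β γ).totalCurrent (μ N (T + δ / 2) (T - δ / 2)) / δ)
      (nhdsWithin 0 {(0 : ℝ)}ᶜ) (nhds (Dn N))) →
      ∀ ε : ℝ, 0 < ε → ∃ N₀ : ℕ, ∀ N : ℕ, N₀ ≤ N → κ - ε ≤ Dn N) :
    Summit.AtomisticToContinuum.FouriersLaw.Theses.LatticeLandauDamping.AbelThermodynamicLimit := by
  intro ω₂ lam β γ hω hl hβ hγ hU T hT hex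
  exact abelThermodynamicLimitRepaired_of_halves hNO hND ω₂ lam β γ hω hl hβ hγ hU T hT
    (hSI ω₂ lam β γ hω hl hβ hγ T hT hex)

/-- **The REPAIRED crux from the two sign laws QS, QSR** (no seam): the planner-repaired statement is closed modulo the two
conjectural, rate-carrying sign laws of line SketchIdeator2. [folklore] -/
theorem abelThermodynamicLimitRepaired_of_signLaws
    (hQS :
      ∀ ω₂ lam β γ : ℝ, 0 < ω₂ → 0 < lam → 0 < β → 0 < γ → ∀ T : ℝ, 0 < T →
      let F : ℕ → ℝ → ℝ := fun N ν =>
      MeasureTheory.integral (MeasureTheory.volume.restrict (Set.Ioi (0:ℝ))) (fun t : ℝ =>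
      Real.exp (-(ν * t)) *
      ∫ z, (∑ i : Fin N, (Literature.MathematicalPhysics.KineticTheory.HeatConduction.pinnedChain ω₂ lam β γ).bondCurrent N i z) *
      (∫ y, (∑ i : Fin N, (Literature.MathematicalPhysics.KineticTheory.HeatConduction.pinnedChain ω₂ lam β γ).bondCurrent N i y) ∂((Literature.MathematicalPhysics.KineticTheory.HeatConduction.pinnedChain ω₂ lam β γ).transitionKernel N T T t.toNNReal z))
      ∂((Literature.MathematicalPhysics.KineticTheory.HeatConduction.pinnedChain ω₂ lam β γ).gibbsMeasure N T));
      ∃ C θ ν₀ : ℝ, ∃ N₀ : ℕ, 0 ≤ C ∧ θ < 1 ∧ 0 < ν₀ ∧ ∀ ν : ℝ, 0 < ν → ν ≤ ν₀ → ∀ N : ℕ, N₀ ≤ N →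
      2 * F N ν - C * ((2 * N : ℕ) : ℝ) ^ θ ≤ F (2 * N) ν)
    (hQSR :
      ∀ ω₂ lam β γ : ℝ, 0 < ω₂ → 0 < lam → 0 < β → 0 < γ → ∀ T : ℝ, 0 < T →
      let F : ℕ → ℝ → ℝ := fun N ν =>
      MeasureTheory.integral (MeasureTheory.volume.restrict (Set.Ioi (0:ℝ))) (fun t : ℝ =>
      Real.exp (-(ν * t)) *
      ∫ z, (∑ i : Fin N, (Literature.MathematicalPhysics.KineticTheory.HeatConduction.pinnedChain ω₂ lam β γ).bondCurrent N i z) *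
      (∫ y, (∑ i : Fin N, (Literature.MathematicalPhysics.KineticTheory.HeatConduction.pinnedChain ω₂ lam β γ).bondCurrent N i y) ∂((Literature.MathematicalPhysics.KineticTheory.HeatConduction.pinnedChain ω₂ lam β γ).transitionKernel N T T t.toNNReal z))
      ∂((Literature.MathematicalPhysics.KineticTheory.HeatConduction.pinnedChain ω₂ lam β γ).gibbsMeasure N T));
      let R : ℕ → ℝ → ℝ := fun N ν => ((N : ℝ) - 1) ^ 2 * T ^ 2 / F N ν;
      ∃ C θ ν₀ : ℝ, ∃ N₀ : ℕ, 0 ≤ C ∧ θ < 1 ∧ 0 < ν₀ ∧ ∀ ν : ℝ, 0 < ν → ν ≤ ν₀ → ∀ N : ℕ, N₀ ≤ N →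
      2 * R N ν - C * ((2 * N : ℕ) : ℝ) ^ θ ≤ R (2 * N) ν) :
    ∀ ω₂ lam β γ : ℝ, 0 < ω₂ → 0 < lam → 0 < β → 0 < γ →
    (∀ (N : ℕ) (T_L T_R : ℝ), 0 < T_L → 0 < T_R → ∀ μ ν : MeasureTheory.Measure (Literature.MathematicalPhysics.KineticTheory.HeatConduction.PhaseSpace N),
    (Literature.MathematicalPhysics.KineticTheory.HeatConduction.pinnedChain ω₂ lam β γ).IsSteadyState N T_L T_R μ → (Literature.MathematicalPhysics.KineticTheory.HeatConduction.pinnedChain ω₂ lam β γ).IsSteadyState N T_L T_R ν → μ = ν) →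
    ∀ T : ℝ, 0 < T →
    (∃ (μT : MeasureTheory.Measure Literature.MathematicalPhysics.KineticTheory.HeatConduction.ChainConfig) (D : Literature.MathematicalPhysics.KineticTheory.HeatConduction.InfiniteChainDynamics (Literature.MathematicalPhysics.KineticTheory.HeatConduction.pinnedChain ω₂ lam β γ)) (κ : ℝ),
    (Literature.MathematicalPhysics.KineticTheory.HeatConduction.pinnedChain ω₂ lam β γ).IsChainGibbsMeasure T μT ∧ Literature.MathematicalPhysics.KineticTheory.HeatConduction.IsShiftInvariant μT ∧ D.PreservesMeasure μT ∧
    (∀ t : ℝ, D.HasAbsConvergentCorrelation μT t) ∧ 0 < κ ∧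
    Filter.Tendsto (fun ν : ℝ => (T ^ 2)⁻¹ * MeasureTheory.integral (MeasureTheory.volume.restrict (Set.Ioi (0:ℝ)))
    (fun t : ℝ => Real.exp (-(ν * t)) * (D.currentCorrelation μT) t)) (nhdsWithin (0:ℝ) (Set.Ioi 0)) (nhds κ)) →
    ∃ (μT : MeasureTheory.Measure Literature.MathematicalPhysics.KineticTheory.HeatConduction.ChainConfig) (D : Literature.MathematicalPhysics.KineticTheory.HeatConduction.InfiniteChainDynamics (Literature.MathematicalPhysics.KineticTheory.HeatConduction.pinnedChain ω₂ lam β γ)) (κ : ℝ),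
    ((Literature.MathematicalPhysics.KineticTheory.HeatConduction.pinnedChain ω₂ lam β γ).IsChainGibbsMeasure T μT ∧ D.PreservesMeasure μT ∧
    (∀ t : ℝ, D.HasAbsConvergentCorrelation μT t) ∧ 0 < κ ∧
    Filter.Tendsto (fun ν : ℝ => (T ^ 2)⁻¹ * MeasureTheory.integral (MeasureTheory.volume.restrict (Set.Ioi (0:ℝ)))
    (fun t : ℝ => Real.exp (-(ν * t)) * (D.currentCorrelation μT) t)) (nhdsWithin (0:ℝ) (Set.Ioi 0)) (nhds κ)) ∧
    ∀ μ : (N : ℕ) → ℝ → ℝ → MeasureTheory.Measure (Literature.MathematicalPhysics.KineticTheory.HeatConduction.PhaseSpace N),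
    (∀ (N : ℕ) (T_L T_R : ℝ), 0 < T_L → 0 < T_R → (Literature.MathematicalPhysics.KineticTheory.HeatConduction.pinnedChain ω₂ lam β γ).IsSteadyState N T_L T_R (μ N T_L T_R)) →
    ∀ Dn : ℕ → ℝ,
    (∀ N : ℕ, Filter.Tendsto (fun δ : ℝ => (Literature.MathematicalPhysics.KineticTheory.HeatConduction.pinnedChain ω₂ lam β γ).totalCurrent (μ N (T + δ / 2) (T - δ / 2)) / δ)
    (nhdsWithin 0 {(0 : ℝ)}ᶜ) (nhds (Dn N))) →
    Filter.Tendsto Dn Filter.atTop (nhds κ) :=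
  abelThermodynamicLimitRepaired_of_halves (noOvershoot_of_quasiSuperadditivity_shiftInvariant hQS)
    (noDeficit_of_quasiSuperadditiveResistance_shiftInvariant hQSR)

/-- **Registered stub `stub_cruxOfSignLaws` (lead c1, rev 8), PROVED: the line's COMPOSITION — QS → QSR → SI → the crux BY
NAME.** It factors through the split: `abelThermodynamicLimit_of_halves` applied to the two sign-law halves; the `Iff.rfl`-twin
`EmbeddedDrudeMourre.AbelThermodynamicLimit` (stmt-12596) follows by `Iff.rfl` from either. [folklore] -/
theorem stub_cruxOfSignLaws :
    (∀ ω₂ lam β γ : ℝ, 0 < ω₂ → 0 < lam → 0 < β → 0 < γ → ∀ T : ℝ, 0 < T →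
    let F : ℕ → ℝ → ℝ := fun N ν =>
    MeasureTheory.integral (MeasureTheory.volume.restrict (Set.Ioi (0:ℝ))) (fun t : ℝ =>
    Real.exp (-(ν * t)) *
    ∫ z, (∑ i : Fin N, (Literature.MathematicalPhysics.KineticTheory.HeatConduction.pinnedChain ω₂ lam β γ).bondCurrent N i z) *
    (∫ y, (∑ i : Fin N, (Literature.MathematicalPhysics.KineticTheory.HeatConduction.pinnedChain ω₂ lam β γ).bondCurrent N i y) ∂((Literature.MathematicalPhysics.KineticTheory.HeatConduction.pinnedChain ω₂ lam β γ).transitionKernel N T T t.toNNReal z))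
    ∂((Literature.MathematicalPhysics.KineticTheory.HeatConduction.pinnedChain ω₂ lam β γ).gibbsMeasure N T));
    ∃ C θ ν₀ : ℝ, ∃ N₀ : ℕ, 0 ≤ C ∧ θ < 1 ∧ 0 < ν₀ ∧ ∀ ν : ℝ, 0 < ν → ν ≤ ν₀ → ∀ N : ℕ, N₀ ≤ N →
    2 * F N ν - C * ((2 * N : ℕ) : ℝ) ^ θ ≤ F (2 * N) ν) →
    (∀ ω₂ lam β γ : ℝ, 0 < ω₂ → 0 < lam → 0 < β → 0 < γ → ∀ T : ℝ, 0 < T →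
    let F : ℕ → ℝ → ℝ := fun N ν =>
    MeasureTheory.integral (MeasureTheory.volume.restrict (Set.Ioi (0:ℝ))) (fun t : ℝ =>
    Real.exp (-(ν * t)) *
    ∫ z, (∑ i : Fin N, (Literature.MathematicalPhysics.KineticTheory.HeatConduction.pinnedChain ω₂ lam β γ).bondCurrent N i z) *
    (∫ y, (∑ i : Fin N, (Literature.MathematicalPhysics.KineticTheory.HeatConduction.pinnedChain ω₂ lam β γ).bondCurrent N i y) ∂((Literature.MathematicalPhysics.KineticTheory.HeatConduction.pinnedChain ω₂ lam β γ).transitionKernel N T T t.toNNReal z))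
    ∂((Literature.MathematicalPhysics.KineticTheory.HeatConduction.pinnedChain ω₂ lam β γ).gibbsMeasure N T));
    let R : ℕ → ℝ → ℝ := fun N ν => ((N : ℝ) - 1) ^ 2 * T ^ 2 / F N ν;
    ∃ C θ ν₀ : ℝ, ∃ N₀ : ℕ, 0 ≤ C ∧ θ < 1 ∧ 0 < ν₀ ∧ ∀ ν : ℝ, 0 < ν → ν ≤ ν₀ → ∀ N : ℕ, N₀ ≤ N →
    2 * R N ν - C * ((2 * N : ℕ) : ℝ) ^ θ ≤ R (2 * N) ν) →
    (∀ ω₂ lam β γ : ℝ, 0 < ω₂ → 0 < lam → 0 < β → 0 < γ →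
    ∀ T : ℝ, 0 < T →
    (∃ (μT : MeasureTheory.Measure
    Literature.MathematicalPhysics.KineticTheory.HeatConduction.ChainConfig)
    (D' : Literature.MathematicalPhysics.KineticTheory.HeatConduction.InfiniteChainDynamics
    (Literature.MathematicalPhysics.KineticTheory.HeatConduction.pinnedChain ω₂ lam β γ))
    (κ : ℝ),
    (Literature.MathematicalPhysics.KineticTheory.HeatConduction.pinnedChain
    ω₂ lam β γ).IsChainGibbsMeasure T μT ∧ D'.PreservesMeasure μT ∧
    (∀ t : ℝ, D'.HasAbsConvergentCorrelation μT t) ∧ 0 < κ ∧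
    Filter.Tendsto (fun ν : ℝ => (T ^ 2)⁻¹ *
    MeasureTheory.integral (MeasureTheory.volume.restrict (Set.Ioi (0:ℝ)))
    (fun t : ℝ => Real.exp (-(ν * t)) * D'.currentCorrelation μT t))
    (nhdsWithin (0:ℝ) (Set.Ioi 0)) (nhds κ)) →
    ∃ (μT : MeasureTheory.Measure
    Literature.MathematicalPhysics.KineticTheory.HeatConduction.ChainConfig)
    (D' : Literature.MathematicalPhysics.KineticTheory.HeatConduction.InfiniteChainDynamics
    (Literature.MathematicalPhysics.KineticTheory.HeatConduction.pinnedChain ω₂ lam β γ))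
    (κ : ℝ),
    (Literature.MathematicalPhysics.KineticTheory.HeatConduction.pinnedChain
    ω₂ lam β γ).IsChainGibbsMeasure T μT ∧
    Literature.MathematicalPhysics.KineticTheory.HeatConduction.IsShiftInvariant μT ∧
    D'.PreservesMeasure μT ∧
    (∀ t : ℝ, D'.HasAbsConvergentCorrelation μT t) ∧ 0 < κ ∧
    Filter.Tendsto (fun ν : ℝ => (T ^ 2)⁻¹ *
    MeasureTheory.integral (MeasureTheory.volume.restrict (Set.Ioi (0:ℝ)))
    (fun t : ℝ => Real.exp (-(ν * t)) * D'.currentCorrelation μT t))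
    (nhdsWithin (0:ℝ) (Set.Ioi 0)) (nhds κ)) →
    Summit.AtomisticToContinuum.FouriersLaw.Theses.LatticeLandauDamping.AbelThermodynamicLimit :=
  fun hQS hQSR hSI => abelThermodynamicLimit_of_halves hSI
    (noOvershoot_of_quasiSuperadditivity_shiftInvariant hQS)
    (noDeficit_of_quasiSuperadditiveResistance_shiftInvariant hQSR)

end Summit.AtomisticToContinuum.FouriersLaw.Theorems.AbelThermodynamicLimit.SeriesLawAtEveryLaplaceFrequency

end
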